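import Summits.BirchSwinnertonDyer.BirchSwinnertonDyer.Theorems.ResidualThetaTransportAtTwoSignedMuSeedAtTwoPlusJetRobertRiccati
import Summits.BirchSwinnertonDyer.BirchSwinnertonDyer.Theorems.ResidualThetaTransportAtTwoSignedMuSeedAtTwoPlusJetLevelOneWall
import Summits.BirchSwinnertonDyer.BirchSwinnertonDyer.Theorems.ResidualThetaTransportAtTwoSignedMuSeedAtTwoPlusJetRhoSymmetrisation
import HarnessLib

/-!
# The `𝔣₀ = 1` Robert function `θ̄ = ∏ᵢ 1/(x + cᵢ)`: 11-jet of the factors, and the LEVEL-0 / LEVEL-1 DICHOTOMY `p₁ ≠ 0 ⟹ NonDeg(1)`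
# (seed lines `norm-field-tilt` S4 / `jet-character-sums` J3–J4 at `𝔣₀ = 1`; crux `SignedMuSeedAtTwoPlus` stmt-BirchSwinnertonDyer-21438; Kμ⁺ stmt-BirchSwinnertonDyer-20689)

Cell `bsd-wall`, width seat `bsd-wall-rtt-p4-w2` g14 (`--supports`, closes nothing).  THEOREMS ONLY (no `def`, no named fact, no instance,
no `sorry`); nothing about any elliptic unit, class or `μ`-invariant is asserted; the lines are NOT registered (W-79); BSD is not proved by this.

Setting (`…JetRobertRiccati`): tilt curve `y² + y = x³` over a commutative ring `R` of characteristic `2`, `w = formalW`, Robert factors `θᵢ` with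
`θᵢ·(t + cᵢ·w) = w` (`θᵢ = 1/(x + cᵢ)`, poles `cᵢ = x(Pᵢ)`), `Φ := Σᵢ θᵢ = D log ∏ᵢ θᵢ` (`prod_mul_sum_eq_derivative_prod`), the DIAGONAL
`ρ`-symmetrisation `S₀ := λΦ(λt) + λ²Φ(λ²t)` (`λ² + λ + 1 = 0`; `[ζ₃]t = ζ₃t` by `Tilt.hom_tiltCurve_eq_C_mul_X`), and the level step
`S₁ := S₀ + S₀(t + δ)` with `δ ≡ ū t⁴ (mod t⁸)` (`…JetLevelStepDelta.levelStep_delta_dvd`).  Write `p₁ := Σᵢ cᵢ`.  Proved: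

* §1 **`X_pow_eleven_dvd_robertFactor_sub`**: `θ_c ≡ t² + c t⁴ + t⁵ + c² t⁶ + c³ t⁸ + c² t⁹ + (c⁴ + c) t¹⁰ (mod t¹¹)` (from `w ≡ t³ + t⁶ (mod t¹²)`,
  explicit certificate), and the coefficients `[t⁰] = [t¹] = [t³] = [t⁷] = 0`, `[t⁴] = c`, `[t⁵] = 1`, `[t⁶] = c²`, `[t⁹] = c²`, `[t¹⁰] = c⁴ + c`.
* §2 the sum: `derivative_robertSum` (`Φ' = Φ²`), `[t⁴]Φ = p₁`, `[t⁶]Φ = [t⁹]Φ = p₁²` (Frobenius), `[t¹⁰]Φ = p₁⁴ + p₁`, `[t⁰] = [t¹] = [t³] = [t⁷] = 0`.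
* §3 level `0`: `S₀' = S₀²`, `[t⁰]S₀ = [t²]S₀ = 0`, **`[t⁴]S₀ = p₁`**, `[t⁶]S₀ = p₁²`, `t⁴ ∣ S₀` (level `0` is ALWAYS degenerate at `𝔣₀ = 1`:
  `v(S₀) ≥ 4 > 4¹ − 2`), and `p₁ = 0 ⟹ t¹² ∣ S₀`.
* §4 level `1`: **`coeff_twelve_levelOne_robertSum`: `[t¹²]S₁ = p₁²·(ū + ū²)`**, `= p₁²` when `ū² + ū + 1 = 0` (`ū = w̄₀ ∈ 𝔽₄ ∖ 𝔽₂`, forced by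
  `N(g) = −1`, `Tilt.levelUnit_not_mem`); `[t¹³]S₁ = 0`, `t¹² ∣ S₁`; hence the DICHOTOMY **`levelOne_robertSum_dichotomy`** and, over a reduced ring,
  **`nonDeg_one_robertSum`: `p₁ ≠ 0 ⟹ v(S₀) = 4 ∧ v(S₁) = 12`** (`order_rhoRobertSum`, `order_levelOne_robertSum`; `12 + 2 < 4²` is `NonDeg(1)`, the
  hypothesis `ha₀/hnd` of `Tilt.oddDigit_of_nonDeg_tiltCurve` with `m₀ = 1`) — the engine's calibration row `(v(S₀), v(S₁)) = (4, 12)` of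
  `Lines/norm-field-tilt.md` as a theorem for EVERY pole configuration with `p₁ ≠ 0`; and `p₁ = 0 ⟹ t¹² ∣ S₀ ∧ t¹⁴ ∣ S₁` (the S4-probe's slow rows).

What this does NOT do: identify `cᵢ`, `ū` with the data of a habitat class (dictionary S1), membership / digits (S1 (iii)), or any `m ≥ 2`.
References: the cards; [SilvermanAEC2009] IV.1 for `w`, `x = t/w`. [folklore]
-/

set_option autoImplicit false
-- the Theorems namespace of this sub repeats the summit name by design (D-0017 nested layout)
set_option linter.dupNamespace false

noncomputable section

open PowerSeries Finset

namespace Summit.BirchSwinnertonDyer.BirchSwinnertonDyer.Theorems.SignedMuAtTwo.JetCharacterSums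

variable {R : Type*} [CommRing R] [CharP R 2]

/-! ## §1 The 11-jet of a Robert factor -/

section Jet

omit [CharP R 2] in
/-- Coefficients below `n` agree when `tⁿ ∣ f − g`. [folklore] -/
theorem coeff_eq_of_X_pow_dvd_sub {f g : R⟦X⟧} {n m : ℕ} (h : (X : R⟦X⟧) ^ n ∣ f - g) (hm : m < n) : coeff m f = coeff m g := by
  obtain ⟨q, hq⟩ := h
  have h1 : f = g + X ^ n * q := by rw [← hq]; ring
  rw [h1, map_add, coeff_X_pow_mul', if_neg (not_le.mpr hm), add_zero]

/-- **The 11-jet of the Robert factor**: `θ_c ≡ t² + c t⁴ + t⁵ + c² t⁶ + c³ t⁸ + c² t⁹ + (c⁴ + c) t¹⁰ (mod t¹¹)` — from `θ·(t + c w) = w` and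
`w ≡ t³ + t⁶ (mod t¹²)`: `w − J·(t + c w) = t¹²·Q + 2·P` for the displayed `J` (explicit `Q`, `P`), then cancel `t + c w = t·unit`.
[cite: SilvermanAEC2009, IV.1.1] -/
theorem X_pow_eleven_dvd_robertFactor_sub {c : R} {θ : R⟦X⟧}
    (hθ : θ * (X + C c * (⟨0, 0, 1, 0, 0⟩ : WeierstrassCurve R).formalW) = (⟨0, 0, 1, 0, 0⟩ : WeierstrassCurve R).formalW) :
    (X : R⟦X⟧) ^ 11 ∣ θ - (X ^ 2 + C c * X ^ 4 + X ^ 5 + C c ^ 2 * X ^ 6 + C c ^ 3 * X ^ 8 + C c ^ 2 * X ^ 9 + (C c ^ 4 + C c) * X ^ 10) := by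
  set w := (⟨0, 0, 1, 0, 0⟩ : WeierstrassCurve R).formalW with hw
  set J : R⟦X⟧ := X ^ 2 + C c * X ^ 4 + X ^ 5 + C c ^ 2 * X ^ 6 + C c ^ 3 * X ^ 8 + C c ^ 2 * X ^ 9 + (C c ^ 4 + C c) * X ^ 10 with hJ
  have h2 := two_eq_zero_powerSeries (R := R)
  obtain ⟨r, hr⟩ := X_pow_dvd_formalW_sub R
  have hwr : w = X ^ 3 + X ^ 6 + X ^ 12 * r := by rw [← hr]; ring
  -- `(θ − J)·(t + c w) = w − J(t + c w) = t¹²·Q` in characteristic `2`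
  have hE : (θ - J) * (X + C c * w) = X ^ 12 * (r - 2 * C c ^ 3 - (C c ^ 2 + C c ^ 5) * X - C c * X ^ 2 * r - C c ^ 4 * X ^ 2
      - C c ^ 3 * X ^ 3 - C c ^ 2 * X ^ 4 - C c ^ 2 * X ^ 4 * r - C c ^ 5 * X ^ 4 - C c * X ^ 5 * r - C c ^ 3 * X ^ 6 * r
      - C c ^ 4 * X ^ 8 * r - C c ^ 3 * X ^ 9 * r - C c ^ 2 * X ^ 10 * r - C c ^ 5 * X ^ 10 * r) := by
    rw [sub_mul, hθ, hJ, hwr]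
    linear_combination (-(C c * X ^ 5 + C c ^ 2 * X ^ 7 + C c * X ^ 8 + C c ^ 3 * X ^ 9 + C c ^ 2 * X ^ 10 +
      (C c + C c ^ 4) * X ^ 11)) * h2
  -- cancel `t + c w = t · u`
  set u := 1 + C c * X ^ 2 * (⟨0, 0, 1, 0, 0⟩ : WeierstrassCurve R).formalWDivCube with hu
  have hinv : u * PowerSeries.invOfUnit u 1 = 1 := robertUnit_mul_invOfUnit c
  rw [robertDen_eq] at hE
  set Q := r - 2 * C c ^ 3 - (C c ^ 2 + C c ^ 5) * X - C c * X ^ 2 * r - C c ^ 4 * X ^ 2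
      - C c ^ 3 * X ^ 3 - C c ^ 2 * X ^ 4 - C c ^ 2 * X ^ 4 * r - C c ^ 5 * X ^ 4 - C c * X ^ 5 * r - C c ^ 3 * X ^ 6 * r
      - C c ^ 4 * X ^ 8 * r - C c ^ 3 * X ^ 9 * r - C c ^ 2 * X ^ 10 * r - C c ^ 5 * X ^ 10 * r with hQ
  have h1 : X * ((θ - J) * u) = X * (X ^ 11 * Q) := by linear_combination hE
  have h3 : (θ - J) * u = X ^ 11 * Q := X_mul_cancel h1
  refine ⟨Q * PowerSeries.invOfUnit u 1, ?_⟩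
  calc θ - J = (θ - J) * (u * PowerSeries.invOfUnit u 1) := by rw [hinv, mul_one]
    _ = X ^ 11 * Q * PowerSeries.invOfUnit u 1 := by rw [← mul_assoc, h3]
    _ = X ^ 11 * (Q * PowerSeries.invOfUnit u 1) := by ring

/-- The coefficients of `θ_c` below `t¹¹` are those of the jet polynomial (written with `C (c^k)` monomials for coefficient extraction). [folklore] -/
theorem coeff_robertFactor_of_lt {c : R} {θ : R⟦X⟧}
    (hθ : θ * (X + C c * (⟨0, 0, 1, 0, 0⟩ : WeierstrassCurve R).formalW) = (⟨0, 0, 1, 0, 0⟩ : WeierstrassCurve R).formalW)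
    {m : ℕ} (hm : m < 11) :
    coeff m θ =
      coeff m (X ^ 2 + C c * X ^ 4 + X ^ 5 + C (c ^ 2) * X ^ 6 + C (c ^ 3) * X ^ 8 + C (c ^ 2) * X ^ 9 + C (c ^ 4) * X ^ 10 +
        C c * X ^ 10 : R⟦X⟧) := by
  have hJ : (X ^ 2 + C c * X ^ 4 + X ^ 5 + C (c ^ 2) * X ^ 6 + C (c ^ 3) * X ^ 8 + C (c ^ 2) * X ^ 9 + C (c ^ 4) * X ^ 10 +
        C c * X ^ 10 : R⟦X⟧) =
      X ^ 2 + C c * X ^ 4 + X ^ 5 + C c ^ 2 * X ^ 6 + C c ^ 3 * X ^ 8 + C c ^ 2 * X ^ 9 + (C c ^ 4 + C c) * X ^ 10 := by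
    simp only [map_pow]; ring
  rw [hJ]
  exact coeff_eq_of_X_pow_dvd_sub (X_pow_eleven_dvd_robertFactor_sub hθ) hm

/-- `[t³]θ_c = 0`. [folklore] -/
theorem coeff_three_robertFactor {c : R} {θ : R⟦X⟧}
    (hθ : θ * (X + C c * (⟨0, 0, 1, 0, 0⟩ : WeierstrassCurve R).formalW) = (⟨0, 0, 1, 0, 0⟩ : WeierstrassCurve R).formalW) :
    coeff 3 θ = 0 := by
  rw [coeff_robertFactor_of_lt hθ (by norm_num)]
  simp only [map_add, coeff_C_mul, coeff_X_pow]
  norm_num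

/-- **`[t⁴]θ_c = c`** (the pole coordinate `x(P)`). [folklore] -/
theorem coeff_four_robertFactor {c : R} {θ : R⟦X⟧}
    (hθ : θ * (X + C c * (⟨0, 0, 1, 0, 0⟩ : WeierstrassCurve R).formalW) = (⟨0, 0, 1, 0, 0⟩ : WeierstrassCurve R).formalW) :
    coeff 4 θ = c := by
  rw [coeff_robertFactor_of_lt hθ (by norm_num)]
  simp only [map_add, coeff_C_mul, coeff_X_pow]
  norm_num

/-- `[t⁵]θ_c = 1`. [folklore] -/
theorem coeff_five_robertFactor {c : R} {θ : R⟦X⟧}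
    (hθ : θ * (X + C c * (⟨0, 0, 1, 0, 0⟩ : WeierstrassCurve R).formalW) = (⟨0, 0, 1, 0, 0⟩ : WeierstrassCurve R).formalW) :
    coeff 5 θ = 1 := by
  rw [coeff_robertFactor_of_lt hθ (by norm_num)]
  simp only [map_add, coeff_C_mul, coeff_X_pow]
  norm_num

/-- **`[t⁶]θ_c = c²`**. [folklore] -/
theorem coeff_six_robertFactor {c : R} {θ : R⟦X⟧}
    (hθ : θ * (X + C c * (⟨0, 0, 1, 0, 0⟩ : WeierstrassCurve R).formalW) = (⟨0, 0, 1, 0, 0⟩ : WeierstrassCurve R).formalW) :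
    coeff 6 θ = c ^ 2 := by
  rw [coeff_robertFactor_of_lt hθ (by norm_num)]
  simp only [map_add, coeff_C_mul, coeff_X_pow]
  norm_num

/-- `[t⁷]θ_c = 0`. [folklore] -/
theorem coeff_seven_robertFactor {c : R} {θ : R⟦X⟧}
    (hθ : θ * (X + C c * (⟨0, 0, 1, 0, 0⟩ : WeierstrassCurve R).formalW) = (⟨0, 0, 1, 0, 0⟩ : WeierstrassCurve R).formalW) :
    coeff 7 θ = 0 := by
  rw [coeff_robertFactor_of_lt hθ (by norm_num)]
  simp only [map_add, coeff_C_mul, coeff_X_pow]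
  norm_num

/-- `[t⁸]θ_c = c³`. [folklore] -/
theorem coeff_eight_robertFactor {c : R} {θ : R⟦X⟧}
    (hθ : θ * (X + C c * (⟨0, 0, 1, 0, 0⟩ : WeierstrassCurve R).formalW) = (⟨0, 0, 1, 0, 0⟩ : WeierstrassCurve R).formalW) :
    coeff 8 θ = c ^ 3 := by
  rw [coeff_robertFactor_of_lt hθ (by norm_num)]
  simp only [map_add, coeff_C_mul, coeff_X_pow]
  norm_num

/-- `[t⁹]θ_c = c²` (`= ([t⁴]θ_c)²`, the Riccati rule `U₉ = U₄²`). [folklore] -/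
theorem coeff_nine_robertFactor {c : R} {θ : R⟦X⟧}
    (hθ : θ * (X + C c * (⟨0, 0, 1, 0, 0⟩ : WeierstrassCurve R).formalW) = (⟨0, 0, 1, 0, 0⟩ : WeierstrassCurve R).formalW) :
    coeff 9 θ = c ^ 2 := by
  rw [coeff_robertFactor_of_lt hθ (by norm_num)]
  simp only [map_add, coeff_C_mul, coeff_X_pow]
  norm_num

/-- `[t¹⁰]θ_c = c⁴ + c`. [folklore] -/
theorem coeff_ten_robertFactor {c : R} {θ : R⟦X⟧}
    (hθ : θ * (X + C c * (⟨0, 0, 1, 0, 0⟩ : WeierstrassCurve R).formalW) = (⟨0, 0, 1, 0, 0⟩ : WeierstrassCurve R).formalW) :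
    coeff 10 θ = c ^ 4 + c := by
  rw [coeff_robertFactor_of_lt hθ (by norm_num)]
  simp only [map_add, coeff_C_mul, coeff_X_pow]
  norm_num

end Jet

/-! ## §2 The Robert sum `Φ = Σᵢ θᵢ` (`𝔣₀ = 1` Robert function `∏ᵢ 1/(x + cᵢ)`, `Φ = D log` of it) -/

section Sum

variable {ι : Type*} {s : Finset ι} {c : ι → R} {θ : ι → R⟦X⟧}
  (hθ : ∀ i ∈ s, θ i * (X + C (c i) * (⟨0, 0, 1, 0, 0⟩ : WeierstrassCurve R).formalW) = (⟨0, 0, 1, 0, 0⟩ : WeierstrassCurve R).formalW)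

include hθ

/-- `Φ' = Φ²`: the Robert sum is a Riccati solution. [folklore] -/
theorem derivative_robertSum : d⁄dX R (∑ i ∈ s, θ i) = (∑ i ∈ s, θ i) ^ 2 :=
  riccati_sum s θ fun i hi => derivative_robertFactor (hθ i hi)

omit [CharP R 2] in
/-- `[t⁰]Φ = 0`. [folklore] -/
theorem coeff_zero_robertSum : coeff 0 (∑ i ∈ s, θ i) = 0 := by
  rw [map_sum]
  exact Finset.sum_eq_zero fun i hi => by rw [coeff_zero_eq_constantCoeff_apply, constantCoeff_robertFactor (hθ i hi)]

omit [CharP R 2] in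
/-- `[t¹]Φ = 0`. [folklore] -/
theorem coeff_one_robertSum : coeff 1 (∑ i ∈ s, θ i) = 0 := by
  rw [map_sum]
  exact Finset.sum_eq_zero fun i hi => coeff_one_robertFactor (hθ i hi)

/-- `[t³]Φ = 0`. [folklore] -/
theorem coeff_three_robertSum : coeff 3 (∑ i ∈ s, θ i) = 0 := by
  rw [map_sum]
  exact Finset.sum_eq_zero fun i hi => coeff_three_robertFactor (hθ i hi)

/-- **`[t⁴]Φ = p₁ = Σᵢ cᵢ`** (the first power sum of the pole coordinates). [folklore] -/
theorem coeff_four_robertSum : coeff 4 (∑ i ∈ s, θ i) = ∑ i ∈ s, c i := by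
  rw [map_sum]
  exact Finset.sum_congr rfl fun i hi => coeff_four_robertFactor (hθ i hi)

/-- **`[t⁶]Φ = Σᵢ cᵢ² = p₁²`** (Frobenius). [folklore] -/
theorem coeff_six_robertSum : coeff 6 (∑ i ∈ s, θ i) = (∑ i ∈ s, c i) ^ 2 := by
  rw [map_sum, sum_pow_char 2 s c]
  exact Finset.sum_congr rfl fun i hi => coeff_six_robertFactor (hθ i hi)

/-- `[t⁷]Φ = 0`. [folklore] -/
theorem coeff_seven_robertSum : coeff 7 (∑ i ∈ s, θ i) = 0 := by
  rw [map_sum]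
  exact Finset.sum_eq_zero fun i hi => coeff_seven_robertFactor (hθ i hi)

/-- `[t⁹]Φ = p₁²`. [folklore] -/
theorem coeff_nine_robertSum : coeff 9 (∑ i ∈ s, θ i) = (∑ i ∈ s, c i) ^ 2 := by
  rw [map_sum, sum_pow_char 2 s c]
  exact Finset.sum_congr rfl fun i hi => coeff_nine_robertFactor (hθ i hi)

/-- `[t¹⁰]Φ = p₁⁴ + p₁`. [folklore] -/
theorem coeff_ten_robertSum : coeff 10 (∑ i ∈ s, θ i) = (∑ i ∈ s, c i) ^ 4 + ∑ i ∈ s, c i := by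
  have h4 : (∑ i ∈ s, c i) ^ 4 = ∑ i ∈ s, c i ^ 4 := by
    rw [show (4 : ℕ) = 2 * 2 from rfl, pow_mul, sum_pow_char 2 s c, sum_pow_char 2 s]
    exact Finset.sum_congr rfl fun i _ => by ring
  rw [map_sum, h4, ← Finset.sum_add_distrib]
  exact Finset.sum_congr rfl fun i hi => coeff_ten_robertFactor (hθ i hi)

end Sum

/-! ## §3 Level `0`: the `ρ`-symmetrised Robert sum `S₀ = λΦ(λt) + λ²Φ(λ²t)` -/

section LevelZero

variable {ι : Type*} {s : Finset ι} {c : ι → R} {θ : ι → R⟦X⟧}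
  (hθ : ∀ i ∈ s, θ i * (X + C (c i) * (⟨0, 0, 1, 0, 0⟩ : WeierstrassCurve R).formalW) = (⟨0, 0, 1, 0, 0⟩ : WeierstrassCurve R).formalW)
  {l : R} (hl : l ^ 2 + l + 1 = 0)

include hθ in
/-- `S₀' = S₀²` (hypothesis `hR` of the walls). [folklore] -/
theorem riccati_rhoRobertSum (l : R) :
    d⁄dX R (C l * rescale l (∑ i ∈ s, θ i) + C (l ^ 2) * rescale (l ^ 2) (∑ i ∈ s, θ i)) =
      (C l * rescale l (∑ i ∈ s, θ i) + C (l ^ 2) * rescale (l ^ 2) (∑ i ∈ s, θ i)) *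
        (C l * rescale l (∑ i ∈ s, θ i) + C (l ^ 2) * rescale (l ^ 2) (∑ i ∈ s, θ i)) :=
  riccati_rhoSymm l (derivative_robertSum hθ)

include hθ hl

/-- `[t⁰]S₀ = 0` (hypothesis `h0` of the walls: level `0` is degenerate). [folklore] -/
theorem coeff_zero_rhoRobertSum : coeff 0 (C l * rescale l (∑ i ∈ s, θ i) + C (l ^ 2) * rescale (l ^ 2) (∑ i ∈ s, θ i)) = 0 := by
  rw [coeff_rhoSymm_eq hl, coeff_zero_robertSum hθ]; simp

omit hθ in
/-- `[t²]S₀ = 0` (hypothesis `h2` of the walls: `2 ≡ 2 (mod 3)` is killed). [folklore] -/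
theorem coeff_two_rhoRobertSum : coeff 2 (C l * rescale l (∑ i ∈ s, θ i) + C (l ^ 2) * rescale (l ^ 2) (∑ i ∈ s, θ i)) = 0 := by
  rw [coeff_rhoSymm_eq hl]; simp

/-- **`T₄ = [t⁴]S₀ = p₁`**. [folklore] -/
theorem coeff_four_rhoRobertSum :
    coeff 4 (C l * rescale l (∑ i ∈ s, θ i) + C (l ^ 2) * rescale (l ^ 2) (∑ i ∈ s, θ i)) = ∑ i ∈ s, c i := by
  rw [coeff_rhoSymm_eq hl, coeff_four_robertSum hθ]; simp

/-- **`T₆ = [t⁶]S₀ = p₁²`**. [folklore] -/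
theorem coeff_six_rhoRobertSum :
    coeff 6 (C l * rescale l (∑ i ∈ s, θ i) + C (l ^ 2) * rescale (l ^ 2) (∑ i ∈ s, θ i)) = (∑ i ∈ s, c i) ^ 2 := by
  rw [coeff_rhoSymm_eq hl, coeff_six_robertSum hθ]; simp

/-- `t⁴ ∣ S₀`: at `𝔣₀ = 1` level `0` is ALWAYS degenerate (`v(S₀) ≥ 4 > 4¹ − 2`). [folklore] -/
theorem X_pow_four_dvd_rhoRobertSum : (X : R⟦X⟧) ^ 4 ∣ C l * rescale l (∑ i ∈ s, θ i) + C (l ^ 2) * rescale (l ^ 2) (∑ i ∈ s, θ i) := by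
  rw [X_pow_dvd_iff]
  intro m hm
  interval_cases m
  · exact coeff_zero_rhoRobertSum hθ hl
  · rw [coeff_rhoSymm_eq hl, coeff_one_robertSum hθ]; simp
  · exact coeff_two_rhoRobertSum hl
  · rw [coeff_rhoSymm_eq hl, coeff_three_robertSum hθ]; simp

/-- **`p₁ = 0 ⟹ t¹² ∣ S₀`** (the slow rows of the S4 probe: `[t⁴] = p₁`, `[t⁶] = [t⁹] = p₁²`, `[t¹⁰] = p₁⁴ + p₁`, `[t⁷] = 0`, and `2, 5, 8, 11` killed). [folklore] -/
theorem X_pow_twelve_dvd_rhoRobertSum_of_sum_eq_zero (hp : ∑ i ∈ s, c i = 0) :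
    (X : R⟦X⟧) ^ 12 ∣ C l * rescale l (∑ i ∈ s, θ i) + C (l ^ 2) * rescale (l ^ 2) (∑ i ∈ s, θ i) := by
  rw [X_pow_dvd_iff]
  intro m hm
  rw [coeff_rhoSymm_eq hl]
  interval_cases m
  · simp [coeff_zero_robertSum hθ]
  · simp [coeff_one_robertSum hθ]
  · simp
  · simp [coeff_three_robertSum hθ]
  · simp [coeff_four_robertSum hθ, hp]
  · simp
  · simp [coeff_six_robertSum hθ, hp]
  · simp [coeff_seven_robertSum hθ]
  · simp
  · simp [coeff_nine_robertSum hθ, hp]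
  · simp [coeff_ten_robertSum hθ, hp]
  · simp

omit hl in
/-- Over a reduced ring: **`p₁ ≠ 0 ⟹ v(S₀) = 4`** exactly. [folklore] -/
theorem order_rhoRobertSum (hl : l ^ 2 + l + 1 = 0) (hp : ∑ i ∈ s, c i ≠ 0) :
    PowerSeries.order (C l * rescale l (∑ i ∈ s, θ i) + C (l ^ 2) * rescale (l ^ 2) (∑ i ∈ s, θ i)) = ((4 : ℕ) : ℕ∞) := by
  rw [order_eq_nat]
  refine ⟨by rwa [coeff_four_rhoRobertSum hθ hl], fun m hm => ?_⟩
  exact (X_pow_dvd_iff.mp (X_pow_four_dvd_rhoRobertSum hθ hl)) m hm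

end LevelZero

/-! ## §4 Level `1`: `S₁ = S₀ + S₀(t + δ)`, `δ ≡ ū t⁴ (mod t⁸)` -/

section LevelOne

variable {ι : Type*} {s : Finset ι} {c : ι → R} {θ : ι → R⟦X⟧}
  (hθ : ∀ i ∈ s, θ i * (X + C (c i) * (⟨0, 0, 1, 0, 0⟩ : WeierstrassCurve R).formalW) = (⟨0, 0, 1, 0, 0⟩ : WeierstrassCurve R).formalW)
  {l : R} (hl : l ^ 2 + l + 1 = 0) {δ : R⟦X⟧} {u : R} (hδ : (X : R⟦X⟧) ^ 8 ∣ δ - C u * X ^ 4)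

include hθ hl hδ

/-- **The level-one wall value at `𝔣₀ = 1`: `[t¹²]S₁ = p₁²·(ū + ū²)`** (`= ūT₄² + ū²T₆` with `T₄ = p₁`, `T₆ = p₁²`). [folklore] -/
theorem coeff_twelve_levelOne_robertSum :
    coeff 12 ((C l * rescale l (∑ i ∈ s, θ i) + C (l ^ 2) * rescale (l ^ 2) (∑ i ∈ s, θ i)) +
        (C l * rescale l (∑ i ∈ s, θ i) + C (l ^ 2) * rescale (l ^ 2) (∑ i ∈ s, θ i)).subst (X + δ)) =
      (∑ i ∈ s, c i) ^ 2 * (u + u ^ 2) := by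
  rw [coeff_twelve_levelOne (riccati_rhoRobertSum hθ l) (coeff_zero_rhoRobertSum hθ hl) (coeff_two_rhoRobertSum hl) hδ,
    coeff_four_rhoRobertSum hθ hl, coeff_six_rhoRobertSum hθ hl]
  ring

/-- **`[t¹²]S₁ = p₁²` when `ū² + ū + 1 = 0`** (`ū ∈ 𝔽₄ ∖ 𝔽₂`: then `ū + ū² = 1`). [folklore] -/
theorem coeff_twelve_levelOne_robertSum_of_rho (hu : u ^ 2 + u + 1 = 0) :
    coeff 12 ((C l * rescale l (∑ i ∈ s, θ i) + C (l ^ 2) * rescale (l ^ 2) (∑ i ∈ s, θ i)) +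
        (C l * rescale l (∑ i ∈ s, θ i) + C (l ^ 2) * rescale (l ^ 2) (∑ i ∈ s, θ i)).subst (X + δ)) =
      (∑ i ∈ s, c i) ^ 2 := by
  have h2 : (2 : R) = 0 := CharTwo.two_eq_zero
  rw [coeff_twelve_levelOne_robertSum hθ hl hδ]
  linear_combination (∑ i ∈ s, c i) ^ 2 * hu - (∑ i ∈ s, c i) ^ 2 * h2

/-- `[t¹³]S₁ = 0` and `t¹² ∣ S₁` (the wall: `v(S₁) ∈ {12} ∪ [14, ∞)`). [folklore] -/
theorem coeff_thirteen_levelOne_robertSum :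
    coeff 13 ((C l * rescale l (∑ i ∈ s, θ i) + C (l ^ 2) * rescale (l ^ 2) (∑ i ∈ s, θ i)) +
        (C l * rescale l (∑ i ∈ s, θ i) + C (l ^ 2) * rescale (l ^ 2) (∑ i ∈ s, θ i)).subst (X + δ)) = 0 ∧
      (X : R⟦X⟧) ^ 12 ∣ (C l * rescale l (∑ i ∈ s, θ i) + C (l ^ 2) * rescale (l ^ 2) (∑ i ∈ s, θ i)) +
        (C l * rescale l (∑ i ∈ s, θ i) + C (l ^ 2) * rescale (l ^ 2) (∑ i ∈ s, θ i)).subst (X + δ) :=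
  ⟨coeff_thirteen_levelOne (riccati_rhoRobertSum hθ l) (coeff_zero_rhoRobertSum hθ hl) (coeff_two_rhoRobertSum hl) hδ,
    (levelOne_dichotomy (riccati_rhoRobertSum hθ l) (coeff_zero_rhoRobertSum hθ hl) (coeff_two_rhoRobertSum hl) hδ).1⟩

/-- **THE `𝔣₀ = 1` DICHOTOMY** (`ū² + ū + 1 = 0`): `t⁴ ∣ S₀`, `t¹² ∣ S₁`, `[t⁴]S₀ = p₁`, `[t¹²]S₁ = p₁²`; so `p₁² ≠ 0 ⟹ [t¹²]S₁ ≠ 0` (`v(S₁) = 12 < 14`: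
`NonDeg(1)`), and `p₁ = 0 ⟹ t¹² ∣ S₀ ∧ t¹⁴ ∣ S₁` (slow class). [folklore] -/
theorem levelOne_robertSum_dichotomy (hu : u ^ 2 + u + 1 = 0) :
    ((X : R⟦X⟧) ^ 4 ∣ C l * rescale l (∑ i ∈ s, θ i) + C (l ^ 2) * rescale (l ^ 2) (∑ i ∈ s, θ i)) ∧
      ((X : R⟦X⟧) ^ 12 ∣ (C l * rescale l (∑ i ∈ s, θ i) + C (l ^ 2) * rescale (l ^ 2) (∑ i ∈ s, θ i)) +
        (C l * rescale l (∑ i ∈ s, θ i) + C (l ^ 2) * rescale (l ^ 2) (∑ i ∈ s, θ i)).subst (X + δ)) ∧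
      coeff 4 (C l * rescale l (∑ i ∈ s, θ i) + C (l ^ 2) * rescale (l ^ 2) (∑ i ∈ s, θ i)) = ∑ i ∈ s, c i ∧
      coeff 12 ((C l * rescale l (∑ i ∈ s, θ i) + C (l ^ 2) * rescale (l ^ 2) (∑ i ∈ s, θ i)) +
        (C l * rescale l (∑ i ∈ s, θ i) + C (l ^ 2) * rescale (l ^ 2) (∑ i ∈ s, θ i)).subst (X + δ)) = (∑ i ∈ s, c i) ^ 2 ∧
      (∑ i ∈ s, c i = 0 →
        (X : R⟦X⟧) ^ 12 ∣ C l * rescale l (∑ i ∈ s, θ i) + C (l ^ 2) * rescale (l ^ 2) (∑ i ∈ s, θ i) ∧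
        (X : R⟦X⟧) ^ 14 ∣ (C l * rescale l (∑ i ∈ s, θ i) + C (l ^ 2) * rescale (l ^ 2) (∑ i ∈ s, θ i)) +
          (C l * rescale l (∑ i ∈ s, θ i) + C (l ^ 2) * rescale (l ^ 2) (∑ i ∈ s, θ i)).subst (X + δ)) := by
  refine ⟨X_pow_four_dvd_rhoRobertSum hθ hl, (coeff_thirteen_levelOne_robertSum hθ hl hδ).2, coeff_four_rhoRobertSum hθ hl,
    coeff_twelve_levelOne_robertSum_of_rho hθ hl hδ hu, fun hp => ⟨X_pow_twelve_dvd_rhoRobertSum_of_sum_eq_zero hθ hl hp, ?_⟩⟩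
  refine (levelOne_dichotomy (riccati_rhoRobertSum hθ l) (coeff_zero_rhoRobertSum hθ hl) (coeff_two_rhoRobertSum hl) hδ).2.2 ?_
  rw [coeff_four_rhoRobertSum hθ hl, coeff_six_rhoRobertSum hθ hl, hp]
  ring

/-- Over a reduced ring (e.g. `𝔽₄ = ℤ₄/(−2)`): **`p₁ ≠ 0 ⟹ v(S₁) = 12`** exactly. [folklore] -/
theorem order_levelOne_robertSum [IsReduced R] (hu : u ^ 2 + u + 1 = 0) (hp : ∑ i ∈ s, c i ≠ 0) :
    PowerSeries.order ((C l * rescale l (∑ i ∈ s, θ i) + C (l ^ 2) * rescale (l ^ 2) (∑ i ∈ s, θ i)) +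
        (C l * rescale l (∑ i ∈ s, θ i) + C (l ^ 2) * rescale (l ^ 2) (∑ i ∈ s, θ i)).subst (X + δ) : R⟦X⟧) =
      ((12 : ℕ) : ℕ∞) := by
  rw [order_eq_nat]
  refine ⟨?_, fun m hm => ?_⟩
  · rw [coeff_twelve_levelOne_robertSum_of_rho hθ hl hδ hu]
    exact fun h => hp (IsReduced.eq_zero _ ⟨2, h⟩)
  · exact coeff_levelOne_eq_zero_of_lt_twelve (riccati_rhoRobertSum hθ l) (coeff_zero_rhoRobertSum hθ hl)
      (coeff_two_rhoRobertSum hl) hδ hm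

/-- **`NonDeg(1)` for the `𝔣₀ = 1` Robert function with `p₁ ≠ 0`** (reduced ring, `λ² + λ + 1 = 0`, `ū² + ū + 1 = 0`, `δ ≡ ūt⁴ (mod t⁸)`):
`v(S₀) = 4` (level `0` degenerate, `4 + 2 ≥ 4¹`) and `v(S₁) = 12` with `12 + 2 < 4²` — exactly the shape `(S m₀).order = a₀`, `a₀ + 2 < 4^(m₀+1)`
(`m₀ = 1`) of `Tilt.oddDigit_of_nonDeg_tiltCurve`; the calibration row `(4, 12)` of the engine table holds for EVERY pole set with `Σ x(Pᵢ) ≠ 0`. [folklore] -/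
theorem nonDeg_one_robertSum [IsReduced R] (hu : u ^ 2 + u + 1 = 0) (hp : ∑ i ∈ s, c i ≠ 0) :
    PowerSeries.order (C l * rescale l (∑ i ∈ s, θ i) + C (l ^ 2) * rescale (l ^ 2) (∑ i ∈ s, θ i)) = ((4 : ℕ) : ℕ∞) ∧
      PowerSeries.order ((C l * rescale l (∑ i ∈ s, θ i) + C (l ^ 2) * rescale (l ^ 2) (∑ i ∈ s, θ i)) +
        (C l * rescale l (∑ i ∈ s, θ i) + C (l ^ 2) * rescale (l ^ 2) (∑ i ∈ s, θ i)).subst (X + δ) : R⟦X⟧) =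
        ((12 : ℕ) : ℕ∞) ∧
      ¬ (4 + 2 < 4 ^ (0 + 1)) ∧ (12 + 2 < 4 ^ (1 + 1)) :=
  ⟨order_rhoRobertSum hθ hl hp, order_levelOne_robertSum hθ hl hδ hu hp, by norm_num, by norm_num⟩

end LevelOne

end Summit.BirchSwinnertonDyer.BirchSwinnertonDyer.Theorems.SignedMuAtTwo.JetCharacterSums

end
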